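import Literature.Computability.Cryptography.ChenQuantumLWEOutputLaw

/-!
# The counting law behind "`Pr[(41)] = 1/p′`" for Chen's Step 9

REPRODUCTION / ANALYSIS OF A CLAIMED RESULT UNDER ADJUDICATION (withdrawn): Yilei Chen, *Quantum
Algorithms for Lattice Problems*, IACR ePrint 2024/555, version of 2024-04-18 [ChenQuantumLattice2024],
Step 9 (§3.5.9, pp. 34–38), eq. (41) `u₁ + ⟨b*[2..n], u[2..n]⟩ ≡ 0 (mod p₁p′)`, claimed to hold with
certainty.  Bundle `papers/QuantumAdvantage/lwe-quantum-autopsy/` (Part 1, STEPS.md §4.4(d)).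
HONEST FRAMING: kernel-checked THEOREMS about a WITHDRAWN algorithm — an exact counting law and its
consequence for the output distribution; a precise negative result, NOT summit progress, no cryptanalytic
claim in either direction.

`ChenQuantumLWEOutputLaw.lean` proves that, whatever kernel `K` acts on coordinate `0` of `|φ8.f⟩`
(eq. (40)), the weight of the outcome `(x′, u′)` is `w(x′)·Q`, independent of `u′ ∈ ℤ_Nⁿ`
(`Shape.outputWeight_eq`).  Eq. (41) read modulo `Q = p′` is a condition `⟨b*[1..n], u′⟩ ≡ γ (mod Q)` on
`u′` alone (for whatever residue `γ` the coordinate-`0` outcome prescribes).  This file proves: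
* `card_fibre_mul` — for `Q ∣ N` and integer coefficients `c` whose residues generate `ℤ_Q` (a Bezout
  witness `w`, `Σ w_t c_t ≡ 1 (mod Q)`), every fibre of the linear form `u′ ↦ Σ_t c_t·(u′_t mod Q)` on `ℤ_Nⁿ`
  has exactly `Nⁿ/Q` elements (translation by `s·w` permutes the fibres);
* `Shape.card_tailResidue_fibre` — the instance `c = b*[1..n]` (paper's `b*[2..n+1]`); the Bezout
  hypothesis holds for Chen's `b*` by eq. (39) (`b*_η ≡ b₁ = -1 (mod p_η)`, `η = 2..κ`) but is NOT part of
  `Shape.Admissible`, so it is an explicit hypothesis;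
* `Shape.eq41_modQ_fraction` — combined with the output law: for every kernel `K`, every coordinate-`0`
  outcome `x′` and every residue `γ`, the outcomes `u′` with `⟨b*[1..n], u′⟩ ≡ γ (mod Q)` carry exactly
  `1/Q` of the weight at `x′`.  So eq. (41) holds with conditional probability exactly `1/Q`, not `1`.
-/

namespace Literature.Computability.Cryptography.Chen2024

open scoped BigOperators

/-! ### A linear form modulo `Q` on `ℤ_Nⁿ` and the size of its fibres -/

/-- The `ℤ_Q`-valued linear form `u′ ↦ Σ_t c_t · (u′_t mod Q)` on `ℤ_Nⁿ` (`Q ∣ N`): eq. (41) read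
modulo `Q = p′`, as a function of `u[2..n+1]`. [cite: ChenQuantumLattice2024, eq. (41) p. 37] -/
def linFormMod {n N : ℕ} (Q : ℕ) (hQN : Q ∣ N) (c : Fin n → ℤ) (u' : Fin n → ZMod N) : ZMod Q :=
  ∑ t, (c t : ZMod Q) * ZMod.castHom hQN (ZMod Q) (u' t)

/-- The linear form is additive. [folklore] -/
theorem linFormMod_add {n N : ℕ} (Q : ℕ) (hQN : Q ∣ N) (c : Fin n → ℤ)
    (u' v : Fin n → ZMod N) :
    linFormMod Q hQN c (u' + v) = linFormMod Q hQN c u' + linFormMod Q hQN c v := by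
  unfold linFormMod
  rw [← Finset.sum_add_distrib]
  refine Finset.sum_congr rfl fun t _ => ?_
  rw [Pi.add_apply, map_add, mul_add]

/-- On the translation vector `s·w` built from a Bezout witness `w` (`Σ w_t c_t ≡ 1 (mod Q)`) the form
takes the value `s mod Q`. [folklore] -/
theorem linFormMod_shift {n N : ℕ} (Q : ℕ) (hQN : Q ∣ N) (c w : Fin n → ℤ)
    (hw : ((∑ t, w t * c t : ℤ) : ZMod Q) = 1) (s : ZMod N) :
    linFormMod Q hQN c (fun t => s * (w t : ZMod N)) = ZMod.castHom hQN (ZMod Q) s := by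
  unfold linFormMod
  simp only [map_mul, map_intCast]
  have h1 : ∑ t, (c t : ZMod Q) * (ZMod.castHom hQN (ZMod Q) s * (w t : ZMod Q))
      = ZMod.castHom hQN (ZMod Q) s * ∑ t, ((w t : ZMod Q) * (c t : ZMod Q)) := by
    rw [Finset.mul_sum]
    refine Finset.sum_congr rfl fun t _ => ?_
    ring
  have hw' : ∑ t, ((w t : ZMod Q) * (c t : ZMod Q)) = 1 := by
    push_cast at hw
    exact hw
  rw [h1, hw', mul_one]

/-- Translation by `(r′−r)·w` maps the `r`-fibre injectively into the `r′`-fibre. [folklore] -/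
theorem card_fibre_le {n N : ℕ} (Q : ℕ) [NeZero N] [NeZero Q] (hQN : Q ∣ N) (c w : Fin n → ℤ)
    (hw : ((∑ t, w t * c t : ℤ) : ZMod Q) = 1) (r r' : ZMod Q) :
    (Finset.univ.filter fun u' : Fin n → ZMod N => linFormMod Q hQN c u' = r).card
      ≤ (Finset.univ.filter fun u' : Fin n → ZMod N => linFormMod Q hQN c u' = r').card := by
  have hv : linFormMod Q hQN c (fun t => (((r' - r).val : ℕ) : ZMod N) * (w t : ZMod N)) = r' - r := by
    rw [linFormMod_shift Q hQN c w hw, map_natCast, ZMod.natCast_zmod_val]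
  apply Finset.card_le_card_of_injOn
    (fun u' => u' + fun t => (((r' - r).val : ℕ) : ZMod N) * (w t : ZMod N))
  · intro a ha
    simp only [Finset.coe_filter, Finset.mem_univ, true_and, Set.mem_setOf_eq] at ha ⊢
    rw [linFormMod_add, ha, hv]
    ring
  · intro a _ b _ hab
    exact add_right_cancel hab

/-- **Counting law.**  If the residues `c_t mod Q` generate `ℤ_Q` (Bezout witness `w`), every fibre of the
linear form on `ℤ_Nⁿ` has exactly `Nⁿ/Q` elements: `#{u′ | Σ c_t u′_t ≡ r} · Q = Nⁿ`. [folklore] -/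
theorem card_fibre_mul {n N : ℕ} (Q : ℕ) [NeZero N] [NeZero Q] (hQN : Q ∣ N) (c w : Fin n → ℤ)
    (hw : ((∑ t, w t * c t : ℤ) : ZMod Q) = 1) (r : ZMod Q) :
    (Finset.univ.filter fun u' : Fin n → ZMod N => linFormMod Q hQN c u' = r).card * Q = N ^ n := by
  have hconst : ∀ r' : ZMod Q,
      (Finset.univ.filter fun u' : Fin n → ZMod N => linFormMod Q hQN c u' = r').card
        = (Finset.univ.filter fun u' : Fin n → ZMod N => linFormMod Q hQN c u' = r).card :=
    fun r' => le_antisymm (card_fibre_le Q hQN c w hw r' r) (card_fibre_le Q hQN c w hw r r')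
  have htot : (Finset.univ : Finset (Fin n → ZMod N)).card
      = ∑ r' : ZMod Q,
          (Finset.univ.filter fun u' : Fin n → ZMod N => linFormMod Q hQN c u' = r').card :=
    Finset.card_eq_sum_card_fiberwise (fun u' _ => Finset.mem_coe.2 (Finset.mem_univ _))
  rw [Finset.sum_congr rfl fun r' _ => hconst r', Finset.sum_const, Finset.card_univ, Finset.card_univ,
    ZMod.card, smul_eq_mul, Fintype.card_fun, ZMod.card, Fintype.card_fin] at htot
  rw [mul_comm]
  exact htot.symm

namespace Shape

variable (S : Shape)

/-- `Q ∣ N` (`N = D²p₁Q`). [cite: ChenQuantumLattice2024, §3.5.9 p. 35] -/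
theorem Q_dvd_N : (S.Q : ℕ) ∣ S.N :=
  ⟨(S.D : ℕ) * S.D * S.p₁, by simp only [Shape.N, Shape.P, PNat.mul_coe]; ring⟩

/-- `⟨b*[1..n], u′⟩ mod Q` — the `u[2..n+1]`-part of eq. (41) modulo `p′`, written with `ZMod.val` as in
`Shape.eq41`. [cite: ChenQuantumLattice2024, eq. (41) p. 37] -/
def tailResidue (u' : Fin S.n → ZMod S.N) : ZMod S.Q :=
  ∑ t, (S.bstar (Fin.succ t) : ZMod S.Q) * (((u' t).val : ℕ) : ZMod S.Q)

/-- `tailResidue` is the linear form `linFormMod Q (b*[1..n])`. [folklore] -/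
theorem tailResidue_eq (u' : Fin S.n → ZMod S.N) :
    S.tailResidue u' = linFormMod S.Q S.Q_dvd_N (fun t => S.bstar (Fin.succ t)) u' := by
  unfold tailResidue linFormMod
  refine Finset.sum_congr rfl fun t _ => ?_
  rw [ZMod.castHom_apply, ZMod.cast_eq_val]

/-- **`#{u′ ∈ ℤ_Nⁿ | ⟨b*[1..n], u′⟩ ≡ γ (mod Q)} · Q = Nⁿ`** for every residue `γ`, under the Bezout
hypothesis on `b*[1..n] mod Q` (true for Chen's `b*` by eq. (39): `b*_η ≡ -1 (mod p_η)`; false for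
degenerate admissible shapes such as `b*[1..n] = 0`). [cite: ChenQuantumLattice2024, eq. (39)–(41) pp. 35–37] -/
theorem card_tailResidue_fibre (w : Fin S.n → ℤ)
    (hw : ((∑ t, w t * S.bstar (Fin.succ t) : ℤ) : ZMod S.Q) = 1) (γ : ZMod S.Q) :
    (Finset.univ.filter fun u' : Fin S.n → ZMod S.N => S.tailResidue u' = γ).card * S.Q
      = (S.N : ℕ) ^ S.n := by
  have h1 : (Finset.univ.filter fun u' : Fin S.n → ZMod S.N => S.tailResidue u' = γ)
      = Finset.univ.filter fun u' : Fin S.n → ZMod S.N =>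
          linFormMod S.Q S.Q_dvd_N (fun t => S.bstar (Fin.succ t)) u' = γ := by
    refine Finset.filter_congr fun u' _ => ?_
    rw [S.tailResidue_eq]
  rw [h1]
  exact card_fibre_mul S.Q S.Q_dvd_N (fun t => S.bstar (Fin.succ t)) w hw γ

/-- **Eq. (41) modulo `p′` holds with conditional probability exactly `1/p′`.**  For every admissible
shape, every kernel `K` on coordinate `0` (any further processing of that coordinate), every
coordinate-`0` outcome `x′` and every residue `γ ∈ ℤ_Q`: the outcomes `u′` with `⟨b*[1..n], u′⟩ ≡ γ (mod Q)`
carry exactly `1/Q` of the total weight at `x′` (Bezout hypothesis on `b*[1..n] mod Q` as above).  Chen's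
Step 9 claimed eq. (41) with certainty. [cite: ChenQuantumLattice2024, §3.5.9 pp. 37–38, eq. (41)] -/
theorem eq41_modQ_fraction (h : S.Admissible) {α' : Type*} (K : α' → ZMod S.N → ℂ) (x' : α')
    (w : Fin S.n → ℤ) (hw : ((∑ t, w t * S.bstar (Fin.succ t) : ℤ) : ZMod S.Q) = 1) (γ : ZMod S.Q) :
    (∑ u' ∈ Finset.univ.filter (fun u' : Fin S.n → ZMod S.N => S.tailResidue u' = γ),
        ‖qftTail (fun z : α' × (Fin S.n → ZMod S.N) => ∑ x, K z.1 x * splitFirst S.phi8f (x, z.2))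
            (x', u')‖ ^ 2) * S.Q
      = ∑ u' : Fin S.n → ZMod S.N,
        ‖qftTail (fun z : α' × (Fin S.n → ZMod S.N) => ∑ x, K z.1 x * splitFirst S.phi8f (x, z.2))
            (x', u')‖ ^ 2 := by
  obtain ⟨wt, hwt⟩ := S.outputWeight_eq h K
  simp_rw [hwt]
  rw [Finset.sum_const, Finset.sum_const, Finset.card_univ, nsmul_eq_mul, nsmul_eq_mul,
    Fintype.card_fun, ZMod.card, Fintype.card_fin]
  have hc : (((Finset.univ.filter fun u' : Fin S.n → ZMod S.N => S.tailResidue u' = γ).card : ℝ))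
      * S.Q = (S.N : ℝ) ^ S.n := by
    exact_mod_cast S.card_tailResidue_fibre w hw γ
  push_cast
  rw [← hc]
  ring

end Shape

end Literature.Computability.Cryptography.Chen2024
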